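import Mathlib
import HarnessLib
import HarnessLib.Audit
import Summits.FinalStateConjecture.Statement
import HarnessLib.Audit.Status.Attr

/-!
Route: TwoBoundarySqueeze

# Route TwoBoundarySqueeze — squeeze the exterior from scri and the horizon — observability plus
rigidity give a C⁰ Kerr endpoint for all complete-scri data, red-shift upgrades it to C², genericity
is one imported crux

It suffices to show X = K1 ∧ K2 ∧ G (plus the known support S). K1 (SqueezeToKerrFamilyC0): for
EVERY admissible
vacuum datum and every MGHD with complete 𝓘⁺, the self-determined exterior O = J⁺(ιX) ∩ I⁻(charts)
carries an
HONEST EXHAUSTIVE N-black-hole final state decomposition in C⁰ — finitely many boosted Kerrs with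
|aᵢ| ≤ Mᵢ (extremal endpoints
allowed) plus a radiation zone converging to η, exhaustive with honest near-zone radii, chart time
future-oriented, every
future-complete normalised null ray from Σ staying in closure O (re-type T2, p126844) — this is the
card's two-boundary squeeze (B2 observability from 𝓘⁺ and 𝓗⁺,
B3 rigidity of the stationary limit, B4 Łojasiewicz–Simon pinning of the parameters) at the
regularity where no horizon
instability can bite. K2 (SubextremalUpgradeC2): if such an honest C⁰ endpoint configuration is
sub-extremal, the development settles
in C² in the summit's own sense — exhaustive future-oriented horizon-normalised charts on the
self-determined exterior O′ with
rays staying in closure O′ (card B1+B5: near-Kerr nonlinear observability, red-shift, Kerr stability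
in
the full sub-extremal range). G (GenericCensorshipThirdLaw): TAME-Christodoulou-generically (one
fixed end, IsTameChristodoulouGeneric, re-type T2) every
MGHD has complete 𝓘⁺ and no honest C⁰ endpoint configuration contains an extremal hole (clause (i)
of the conjecture and the
generic third law, imported as ONE generic statement because (tame) Christodoulou genericity is not
closed under conjunction). S (MGHDExists): Choquet-Bruhat–Geroch
over the repaired development structure. Card realised:
two-boundary-squeeze-observability-lojasiewicz (absorbing
lojasiewicz-simon-at-the-two-boundaries).
Lean: `SqueezeToKerrFamilyC0 ∧ SubextremalUpgradeC2 ∧ GenericCensorshipThirdLaw ∧ MGHDExists`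

## Assembly
Pure logic (sorry-free in Sketch.lean, theorem `closes`, rendered from glue.lean; re-elaborated
2026-08-16 against the re-typed
statement p126844): TAME Christodoulou codimension is ANTITONE in the exceptional set — if P → Q
pointwise on the admissible class
then IsTameChristodoulouGeneric 𝓓 P 1 → IsTameChristodoulouGeneric 𝓓 Q 1 (the same end and the same
tame immersed family that
leaves the P-exceptional set leaves the smaller Q-exceptional set). Take P = the generic property of
G and Q = the
summit's property; pointwise on 𝓓: S gives the MGHD, G's clause gives complete 𝓘⁺ for every MGHD, K1
gives an honest exhaustive C⁰
decomposition d₀ (O = exteriorOf d₀.charted, RaysStayInClosure O, HasExhaustiveCharts d₀,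
IsFutureOriented d₀), G's second clause
makes d₀ sub-extremal, K2 upgrades to the sub-extremal C² decomposition with the same four clauses —
verbatim the summit's conjunct. Hence K1 → K2 → G → S → FinalStateConjecture.

Rationale: WHY THIS LINE. Mechanism (card two-boundary-squeeze-observability-lojasiewicz): the domain of outer
communications is squeezed from its two
null boundaries — Bondi mass loss makes the news square-integrable on 𝓘⁺ and Carleman unique
continuation from infinity
(Alexakis–Schlue–Shao arXiv:1312.1989; the exact infinite-window vacuum case "time-periodic ⇒
stationary near 𝓘⁺" is
Alexakis–Schlue arXiv:1504.04592, BicakScholtzTod2010) propagates the approximate time symmetry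
inward to the photon region,
while the red-shift (DafermosRodnianski2013, DafermosRodnianski2009) propagates quiescence outward
from 𝓗⁺; the fronts meet at
the normally hyperbolic trapped set, crossed with logarithmic loss (Wunsch–Zworski arXiv:1003.4640,
Dyatlov arXiv:1403.6401),
so the ω-limit is stationary, hence Kerr zone by zone (AlexakisIonescuKlainerman2009,
IonescuKlainerman2012, ChruscielCosta2008),
and parameter drift along the Kerr family is killed by a Łojasiewicz–Simon inequality (Simon,
doi:10.2307/2006981) for the
first-law deficit 𝓕 = M_B − 𝔪(A_H, J), whose flux identity is Hollands–Wald's canonical-energy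
balance (arXiv:1201.0463) and
whose critical manifold is exactly the Kerr family. Imported areas: control theory (observability
inequalities and LaSalle's
invariance principle), Carleman estimates / unique continuation, gradient-flow convergence theory
(Łojasiewicz–Simon), and
semiclassical analysis of normally hyperbolic trapping; the linear near-Kerr shadow of K2∘K1 is
known — unitarity of the
scattering map for linearised gravity on Schwarzschild (Masaood arXiv:2007.13658, arXiv:2211.07462)
and DRSR decay/scattering on
sub-extremal Kerr (DafermosRodnianskiShlapentokhrothman2014,
DafermosRodnianskiShlapentokhrothman2018). What the line adds to a
ledger with no open FSC route: a typed, rate-free seam between WHERE a complete-𝓘⁺ development goes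
(K1, C⁰, all data,
extremal endpoints allowed — exactly the regularity at which the catalogued horizon instability is
silent) and HOW WELL it
converges (K2, C², sub-extremal), with all genericity quarantined in one crux (G) and the assembly
reduced to the antitonicity of
TAME Christodoulou codimension in the exceptional set (closes). STATEMENT RE-TYPE T2 (p126844,
2026-08-16; tame genericity
on one fixed end, honest near-zone radii, chart time orientation, intrinsic lower bound on the
settled region): K1, K2, G
were RESTATED 1:1 to thread the new clauses — K1 now outputs an HONEST C⁰ endpoint
(RaysStayInClosure, HasExhaustiveCharts
with honest radii, IsFutureOriented), K2 consumes it and returns the summit's five-clause conjunct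
verbatim, G is stated
with IsTameChristodoulouGeneric and its clause (ii) ranges over honest C⁰ configurations only
(weaker, hence more
plausible, than over all exhaustive ones); S became a rank-9 crux (crux-only deciding theorem);
`closes` re-elaborated.

RANKED CRUXES. #2 SqueezeToKerrFamilyC0 (crux) — [card B2+B3+B4, C⁰ level, all data; restated
2026-08-16 for T2] for
every connected Hausdorff second-countable 3-manifold X, every admissible vacuum datum D on X and
every
maximal vacuum Cauchy development 𝒟 of D with complete future null infinity (sojourn form), there
are a region O and an N-black-hole final state decomposition d of O in C⁰ (N ≥ 0 boosted translated
Kerr exteriors with 0 < Mᵢ, |aᵢ| ≤ Mᵢ, near-zone C⁰ convergence on every truncated slab, separating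
holes, a flat chart converging to η on the late half-space minus sublinear tubes) such that O =
J⁺(ιX) ∩ I⁻(d.charted) is the exterior the charts themselves determine, every future-complete
normalised null ray
from Σ stays in closure O (RaysStayInClosure), the charts EXHAUST O with HONEST radii Rᵢ(τ) ≥
max(r₊,0)+1, Rᵢ → ∞
(HasExhaustiveCharts: growing certified near zones, every uncertified point of O causally below the
certified slab of every chart time) and chart time is FUTURE-ORIENTED (IsFutureOriented:
orthochronous motions,
push-forwards of the backgrounds' future timelike fields eventually future-directed). In words:
complete 𝓘⁺ alone forces the exterior to settle, in
C⁰, onto finitely many Kerr black holes plus radiation; the intended proof is the two-boundary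
observability squeeze (𝓘⁺-inward Carleman continuation of the approximate time symmetry, 𝓗⁺-outward
red-shift, log-lossy crossing of the trapped set) giving an asymptotically stationary exhaustion,
smooth stationary-vacuum rigidity identifying each zone's limit with a Kerr exterior, and
Łojasiewicz–Simon for the first-law deficit M_B − 𝔪(A,J) giving finite parameter path length (no
drift along the Kerr family, N eventually constant). [difficulty: open-problem] (why it might fail:
All complete-scri data, not generic: it contains smooth Kerr uniqueness (open beyond
near-Kerr/analytic: ChruscielCostaHeusler2012), no vacuum breathers (only exact periodicity is
excluded, near scri: AlexakisSchlue2018), no eternal bound binary or endless cascade; at κ→0 no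
red-shift leg exists.) [ChruscielCostaHeusler2012, AlexakisSchlue2018, arXiv:1312.1989,
BicakScholtzTod2010, AlexakisIonescuKlainerman2009, IonescuKlainerman2012, DafermosRodnianski2013,
arXiv:1201.0463, doi:10.2307/2006981, arXiv:1003.4640, arXiv:1403.6401, DafermosLuk2017,
Dafermos2025, arXiv:2601.01517, AngelopoulosKehleUnger2024]
#3 SubextremalUpgradeC2 (crux) — [card B1+B5; restated 2026-08-16 for T2] for X, D, 𝒟 as above with
complete 𝓘⁺: if O
carries an HONEST exhaustive C⁰ final state decomposition d₀ (O = J⁺(ιX) ∩ I⁻(d₀.charted),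
RaysStayInClosure O,
HasExhaustiveCharts d₀, IsFutureOriented d₀) all of whose holes are SUB-extremal (|aᵢ| < Mᵢ), then
some region O′
carries a C² final state decomposition d with sub-extremal holes, O′ = J⁺(ιX) ∩ I⁻(d.charted),
RaysStayInClosure O′,
HasExhaustiveCharts d and IsFutureOriented d — verbatim the summit's own conclusion for this
development. In words: an eternally C⁰-near-sub-extremal-Kerr vacuum exterior with complete 𝓘⁺
converges in C²; intended proof: eventual uniform red-shift (κ → κ_∞ > 0) plus near-Kerr nonlinear
observability — the robust (GKS/DHRT/Hintz-type; nonlinear Kerr stability now holds on the full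
range |a| < M, Hintz2026 Thm 1.1) version of the unitarity of linear scattering, "energy on a late
leaf = flux through 𝓗⁺ ∪ 𝓘⁺ after it" — so that the L²(𝓘⁺) news and the horizon flux drain every
derivative, Łojasiewicz–Simon near the Kerr manifold supplying the (degenerate-exponent,
inverse-polynomial) rate; horizon-normalised charts then give HasExhaustiveCharts. [deps:
SqueezeToKerrFamilyC0] [difficulty: open-problem] (why it might fail: Kerr stability for all |a|<M
(Hintz2026, Thm 1.1) needs H^d-small polyhomogeneous data; C⁰-nearness in free charts controls
neither derivatives nor tails: an eternal high-frequency (Burnett-type) graviton gas, or C⁰ charts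
fitting sub-extremal labels to extremal geometry, breaks the C² upgrade — the live hazard is the
CAPTURE step, not the range of a.) [Hintz2026, MaSzeftel2024, HuneauLuk2024survey,
DafermosHolzegelRodnianskiTaylor2021, KlainermanSzeftel2023, GiorgiKlainermanSzeftel2022,
ShlapentokhrothmanCosta2020, ShlapentokhrothmanCosta2023, DafermosRodnianskiShlapentokhrothman2014,
DafermosRodnianskiShlapentokhrothman2018, arXiv:2007.13658, arXiv:2211.07462,
DafermosRodnianski2009, Aretakis2015]
#4 GenericCensorshipThirdLaw (crux) — [imported input: clause (i) + generic third law, ONE generic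
statement; restated 2026-08-16 with TAME genericity] for every X as above, the set of admissible
vacuum data D for
which SOME maximal vacuum Cauchy development either has incomplete future null infinity or admits an
HONEST exhaustive
C⁰ final state decomposition (self-determined exterior, rays stay in its closure, honest radii,
future-oriented)
containing a hole with |aᵢ| = Mᵢ has positive TAME codimension in Christodoulou's sense inside the
admissible class
(IsTameChristodoulouGeneric … 1: through each such datum passes an injective one-parameter family of
admissible data,
jointly smooth, tame on ONE fixed asymptotically flat end — Dafermos–Rodnianski rates with
continuous mass, continuous at
c = 0 in the weighted C²₋₁ × C¹₋₂ distance — and immersed at c = 0, all of whose other members have,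
for every MGHD,
complete 𝓘⁺ and only sub-extremal honest C⁰ endpoint configurations). This is weak cosmic censorship
in the
audited typing conjoined with "extremal black holes do not form generically"; it carries no settling
claim. It must be ONE crux: tame Christodoulou genericity of P and of Q does not give genericity of
P ∧
Q. [difficulty: open-problem] (why it might fail: Both clauses open (WCC: Christodoulou1999; generic
third law, extremality forms on the collapse threshold: KehleUnger2024 = arXiv:2402.10190) and
genericity is not ∧-closed (a Christodoulou curve leaving the naked-singularity set may run inside
the extremal-endpoint set); if Kerr labels are not C⁰-rigid (extremal labels on sub-extremal
endpoints), every trapped-surface datum is exceptional and codimension 1 fails.) [Christodoulou1999,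
DafermosLuk2017, KehleUnger2025, KehleUnger2024, arXiv:2402.10190, AngelopoulosKehleUnger2024,
Dafermos2025, RodnianskiShlapentokhRothman2023, Christodoulou2008, Aretakis2015]
#9 MGHDExists (crux, rank 9; re-kinded support→crux 2026-08-16 under the crux-only deciding-theorem
rule, as on
HomotheticSurfaceGravity/NoVacuumStrings) — every admissible vacuum datum (smooth, constraints,
complete, one strongly
asymptotically flat end) has a maximal vacuum Cauchy development in the repaired typing
(VacuumCauchyDevelopment … IsMaximal): Choquet-Bruhat–Geroch 1969 / Sbierski's dezornification, over
the corrected Cauchy-hypersurface notion. Known in print; the anti-vacuity conjunct of the summit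
statement, kept out of the generic crux so that G stays purely about censorship and extremality. It
is VERBATIM the corollary
`Literature.Geometry.Lorentzian.choquetBruhat_geroch_exists_mghd_cauchy.forall_mem_admissibleVacuumData`
(AdmissibleMGHDExistence.lean) of the named fact
`Literature.Geometry.Lorentzian.choquetBruhat_geroch_exists_mghd_cauchy`
(CauchyProblemMGHDExistence.lean; unproved Literature IOU): once that fact has a `_holds`, this item
closes by `exact h.forall_mem_admissibleVacuumData` — needs-fact:
choquetBruhat_geroch_exists_mghd_cauchy. (why it might fail: known in print but typed over the
REPAIRED prelude —
IsMaximal asks EVERY typed VacuumCauchyDevelopment of D to embed; a rogue typed development, as over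
the first
uninhabited rendering, would kill it.) [difficulty: XL] [ChoquetBruhatGeroch1969CMP,
Ringstrom2009, Sbierski2016AHP]

TWO-LAYER PLAN. Foreseen glued splits (none filed now; each k ≤ 3, depth 1). K1 ⇐
SqueezeToStationarity → StationaryExhaustionIsKerrC0 → K1, now that
the definition request D1 has LANDED as
`Literature.Geometry.Lorentzian.AsymptoticallyStationaryExhaustion` (structure;
AsymptoticallyStationaryExhaustion.lean): SqueezeToStationarity = complete 𝓘⁺ ⇒ an asymptotically
stationary exhaustion of O (the pure observability statement B2, the card's rank-2 bet, with the
trapped-set crossing lemma and the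
red-shift leg as its prover-attached lemmas); StationaryExhaustionIsKerrC0 = rigidity of the
zone-wise stationary vacuum limits
(B3; conditional globally on smooth Kerr uniqueness, Alexakis–Ionescu–Klainerman near Kerr) +
Łojasiewicz–Simon on the first-law
deficit (B4; needs D3 and Morse–Bott non-degeneracy = coercive canonical energy modulo gauge and
Kerr directions for |a| < M).
K2 ⇐ NearKerrObservability (dist(slab, Kerr family)² ≤ C_L·(news + horizon flux on a window) + leak,
the robust form of Masaood/DRSR
unitarity; needs D3) → FullRangeKerrCapture (sub-extremal Kerr stability in consequence form over
VacuumCauchyDevelopment, fed by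
Hintz2026 Thm 1.1/13.1 nonlinearly for H^d-small polyhomogeneous data and by
ShlapentokhrothmanCosta2020/2023 linearly) → K2. G ⇐ by which exceptional set the datum lies in:
CensorshipCurves (through a
naked-singularity datum, an admissible curve avoiding BOTH exceptional sets) → ThresholdCurves
(through a censored datum with an
extremal C⁰ endpoint, an admissible curve off the Kehle–Unger threshold and off the
naked-singularity set) → G. D2 has LANDED as
`Literature.Geometry.Lorentzian.LorentzianMetric.HasSurfaceGravityGe` with
`Literature.Geometry.Lorentzian.CauchyDevelopment.eventHorizonOf` (RedShiftedHorizon.lean), so K1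
may now be honestly RESTATED in tenure as "complete 𝓘⁺ ∧ eventually red-shifted ⇒ C⁰
(indeed C²) sub-extremal endpoint" with G supplying eventual red-shift generically — the same
squeeze, minus the degenerate sector.

KILL CRITERIA. A vacuum MGHD from admissible data with complete 𝓘⁺ whose exterior provably does not
settle in C⁰ (a "silent non-settler":
news → 0 in L²([u,∞)) but non-stationary ω-limit, e.g. a photon-sphere graviton breather, or an
endless cascade of ever smaller
holes) refutes K1: if the witness has asymptotically degenerate horizons, pivot by restating K1
under EventuallyRedShiftedHorizon
(D2) and strengthening G; otherwise `close --reason refuted:SqueezeToKerrFamilyC0` — the squeeze is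
dead. An eternally
C⁰-near-sub-extremal-Kerr exterior that does not converge in C² refutes K2 and with it the near-Kerr
observability leg: close
refuted:SubextremalUpgradeC2. A proof that the union of the censorship- and
extremal-endpoint-exceptional sets fails TAME Christodoulou
codimension 1 on some X refutes G and, via closes-type monotonicity, the summit statement as typed
(hand to the statement auditors;
the dynamical cruxes K1, K2 survive as theorems about complete-𝓘⁺ developments). K1 ∧ K2 proved
along another route (e.g. a
quiet-window/Kerr-stability capture) moots this one; the items are shared by signature.

NOT DECOMPOSED YET. Deliberately not items at open: the quantitative observability inequality and
its loss (exp(CL) Carleman cost versus the log loss at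
normally hyperbolic trapping); the trapped-set crossing lemma; Bondi mass / news flux over the
repaired structures
— definition request D3, now LANDED as
`Literature.Geometry.Lorentzian.DataEmbedding.BondiFoliation.newsPower` / `newsFlux`
(BondiNewsFlux.lean, over DataEmbedding, not the uninhabited Development), the flux side still to be
tied to K1/K2 by provers; the smooth stationary-vacuum rigidity input as
a typed statement (the prelude's AlexakisIonescuKlainermanRigidity schema needs an I⁺-regularity /
simple-connectivity predicate the
prelude lacks: at the trivial predicate it is FALSE — Minkowski with ∂ₜ, extremal Kerr and the
time-periodic ℤ-quotient of Kerr all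
instantiate StationaryAFBlackHole); Morse–Bott non-degeneracy of the first-law deficit at Kerr
(coercivity of canonical energy,
known only at a = 0); the N ≥ 2 kinematics (holes separate, terminal boosts exist); the
horizon-normalised chart construction behind
HasExhaustiveCharts; the linear Schwarzschild toy (finite-window observability from 𝓘⁺ ∪ 𝓗⁺ with
loss), which is a corollary of
DRSR/Masaood and therefore not filed as an item.

CHEAPEST FALSIFIER. (1) Typing/anti-vacuity check a refuter can run in Lean: exact
Schwarzschild/Kerr developments must satisfy K1's conclusion at k = 0
with horizon-normalised charts (the g6 audit's §D2 check was done at k = 2; the same charts work) —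
if HasExhaustiveCharts were
unsatisfiable at k = 0 for exact Kerr, K1 is dead on typing. (2) Literature check (done, 2026-08-15:
zbMATH "time-periodic vacuum
Einstein stationary" → only arXiv:1504.04592, which EXCLUDES the periodic non-settler near 𝓘⁺; no
eternal non-stationary vacuum
exterior with complete 𝓘⁺ is in print). (3) The linear infinite-window version of K2∘K1 on
Schwarzschild — a finite-energy solution
of linearised gravity with vanishing radiation fields on 𝓘⁺ and 𝓗⁺ after some retarded/advanced time
vanishes to the future of a
late leaf — is TRUE (Masaood arXiv:2007.13658: the scattering map is unitary), so the cheapest live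
falsifier is (4): can a
sub-extremal and an extremal Kerr exterior be C⁰-close in SOME charts on whole near zones {r₊ < r ≤
R} for every R (C⁰ non-rigidity
of the parameters)? If yes, G's third-law clause and K2's hypothesis decouple from the geometry and
must be re-typed at C¹ off the
horizon.

NUMBERS. Nonlinear Kerr stability: the FULL sub-extremal range |a| < M, for perturbations of Kerr
data that are H^d-small (d large) and
compactly supported or partially polyhomogeneous, with |g − g_b| ≲ (1+t̃)^(−2−ε) on spatially
compact sets (Hintz2026 = arXiv:2606.28253,
Thm 1.1, p. 2; precise form Thm 13.1; t̃⁻³ by Rem. 1.2), superseding |a|/M ≪ 1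
(KlainermanSzeftel2023, GiorgiKlainermanSzeftel2022) and
Schwarzschild codimension-3 data (DafermosHolzegelRodnianskiTaylor2021). Linear: Teukolsky
boundedness/decay on the full range |a| < M (ShlapentokhrothmanCosta2020,
ShlapentokhrothmanCosta2023); scalar waves |a| < M with exactly one derivative lost at trapping
(DafermosRodnianskiShlapentokhrothman2014,
Thm 3.2); Price law τ⁻³ (Hintz2021) ⇒ any Łojasiewicz exponent here is θ < ½ (polynomial, not
exponential, rates). Unique
continuation from 𝓘⁺: linear waves on positive-mass backgrounds, pseudoconvexity improving with the
mass (arXiv:1312.1989); vacuum,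
exactly time-periodic ⇒ stationary near 𝓘⁺ (arXiv:1504.04592). Extremal endpoints: third law false,
extremal formation on the
collapse threshold in the charged models (KehleUnger2025, arXiv:2402.10190); C⁰ (not C¹) convergence
to the extremal member proved
in spherical symmetry (AngelopoulosKehleUnger2024, Thm 1). Items: 5 (4 cruxes of which one is the
rank-9 existence input S, 0 support, 1
assembly). Dependency cone (route-repair g2/g3, 2026-08-15, re-checked on the T2 restatement
2026-08-16 in Sketch.lean):
the used-constants cone of the items and `closes` contains no unproved named fact and no sorry,
axioms ⊆
{propext, Classical.choice, Quot.sound}; the only project import is the mandatory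
Summits.FinalStateConjecture.Statement;
the three refuted @[deprecated] Causality tombstones in the Statement's own import cone are used by
no declaration
(hygiene item defn-CausalityTombstones). Genuinely needed unproved Literature fact (item S only):
needs-fact:
choquetBruhat_geroch_exists_mghd_cauchy (CauchyProblemMGHDExistence.lean;
CauchyProblemMGHDExistenceProofs
already reduces it to the chain-upper-bound and common-extension constructions of CBG 1969 pp.
332–334).

DEFINITION REQUESTS. D1–D3, filed at open, have LANDED (2026-08-15): D1 =
`Literature.Geometry.Lorentzian.AsymptoticallyStationaryExhaustion`
(AsymptoticallyStationaryExhaustion.lean: finitely many late charts plus a far chart exhausting O,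
uniform C^(k+1) regularity, truncated
stationarity moduli `Spacetime.truncStationarityCk` tending to 0 — the output of the observability
squeeze B2 and the hypothesis of the
rigidity + Łojasiewicz step); D2 =
`Literature.Geometry.Lorentzian.LorentzianMetric.HasSurfaceGravityGe` with
`Literature.Geometry.Lorentzian.CauchyDevelopment.eventHorizonOf` (RedShiftedHorizon.lean: the event
horizon ∂I⁻(U) eventually admits
surface gravity ≥ κ₀ > 0 — the B5 red-shift input); D3 =
`Literature.Geometry.Lorentzian.DataEmbedding.BondiFoliation.newsPower` /
`newsFlux` (BondiNewsFlux.lean: the news power and its flux over a Bondi foliation of a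
DataEmbedding — the Lyapunov/flux side of every
observability and Łojasiewicz–Simon inequality of the line). The cite-fact wanted at open landed as
the NAMED FACT
`Literature.Geometry.Lorentzian.choquetBruhat_geroch_exists_mghd_cauchy`
(CauchyProblemMGHDExistence.lean; ChoquetBruhatGeroch1969CMP Thm 3,
Sbierski2016AHP Thm 2.8, Ringstrom2009 Thm 16.6), whose admissible-class corollary
`choquetBruhat_geroch_exists_mghd_cauchy.forall_mem_admissibleVacuumData`
(AdmissibleMGHDExistence.lean) is MGHDExists verbatim; the fact is
unproved and is this route's one needs-fact. Nothing further is requested for the line; tenure may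
file the foreseen
glued splits of K1/K2 over D1–D3 (hygiene item defn-CausalityTombstones filed by route-repair g3,
see NUMBERS).

Novelty: Searches (2026-08-15; local searchd rc 75 and OpenAlex/S2/arXiv HTTP 429 at filing, so zbMATH +
galaxy): lit search --source zbmath
"unique continuation from infinity" (12; relevant arXiv:1312.1989), "time-periodic vacuum Einstein
stationary Alexakis Schlue" (1:
arXiv:1504.04592), "extremal black hole formation third law thermodynamics gravitational collapse"
(3: arXiv:2211.15742, 2411.17938,
2604.27976), "extremal black hole formation critical phenomenon Kehle Unger" (1: arXiv:2402.10190),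
"scattering theory linearised
gravity Schwarzschild" (7: arXiv:2007.13658, 2211.07462, 2401.04179 …), "Lojasiewicz-Simon
convergence stationary black hole general
relativity" (0), "observability inequality wave equation Schwarzschild black hole" (0),
"asymptotically stationary spacetime late
time stationary limit black hole" (0); lit galaxy search --star all "unique continuation from
infinity" (1 unrelated book),
"Lojasiewicz-Simon inequality" (8 pdf, all curve/elastic flows, none GR); --star pdf "time-periodic
vacuum spacetimes" (1),
"asymptotically stationary" (20, none GR). Plus the card's two refuter audits (units 1 and 5: zbMATH
"asymptotically stationary
implies stationary" 0, "Lojasiewicz-Simon general relativity" 0, galaxy nil; Holzegel–Shao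
arXiv:1508.03820/2207.14217 found as
the AdS-boundary analogue).
Nearest prior art found: arXiv:1504.04592 (Alexakis–Schlue: Carleman from 𝓘⁺ for the vacuum EINSTEIN
equations, exact
periodic ⇒ stationary near 𝓘⁺ — the flux = 0, infinite-window  [refs: 1312.1989, 1504.04592, 2211.15742, 2402.10190, 2007.13658, 1508.03820, 2207.14217, 1201.0463, DafermosRodnianskiShlapentokhrothman2018]

Barriers (technique_class: unique-continuation, observability, Lojasiewicz, red-shift): - technique_class: unique-continuation, observability, Lojasiewicz, red-shift
- Literature.Barriers.FinalStateConjecture.IonescuKlainermanNonExtension: no Killing field is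
extended ACROSS a horizon from local data; the approximate symmetry is continued inward from 𝓘⁺
(global information) and the horizon side uses red-shift decay, not rigidity; the global
smooth-uniqueness input of K1 is flagged as conditional and must come from the 𝓘⁺ side — agreed with
the barrier.
- Literature.Barriers.FinalStateConjecture.SbierskiTrappingObstruction: the crossing lemma at the
photon region is allowed to lose derivatives/logarithms (semiclassical normally-hyperbolic
estimates); no first-order, loss-free uniform LED is claimed anywhere in K1 or K2.
- Literature.Barriers.FinalStateConjecture.KerrSuperradiance: neither the Carleman estimates nor the
flux identity for M_B − 𝔪(A,J) uses positivity of a Killing energy in the ergoregion; the horizon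
term is the shear square (area law), positive regardless of superradiance.
- Literature.Barriers.FinalStateConjecture.KerrSuperradianceNarrow: (B1) not met — no exactly
conserved Killing current supplies coercivity anywhere in the line: K1's Lyapunov functional is the
Bondi mass / first-law deficit M_B − 𝔪(A_H, J), monotone by the news flux at 𝓘⁺ and the shear flux
through 𝓗⁺ (area law), both sign-definite irrespective of the ergoregion, not a ∂_t-energy density
on a slice; (B2) not met — the red-shift enters only as the Dafermos–Rodnianski local horiz

History (route lifecycle, newest last):
- 2026-08-16T23:15:52Z · rev 8: restated SqueezeToKerrFamilyC0 (stmt-FinalStateConjecture-9994), SubextremalUpgradeC2 (stmt-FinalStateConjecture-9995), GenericCensorshipThirdLaw (stmt-FinalStateConjecture-9996) — route-repair statement-revised (p126844, re-type T2): K1/K2/G restated 1:1 (same decl names) to thread the new conjuncts — K1 output (planner-rrepair-FinalStateConjecture-TwoBounda-598539ae-0)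
- 2026-08-24T06:17:28Z · DORMANT — reconciler: no traction for 6.6 d (last activity item-evidence-added at 2026-08-17T15:45:33Z); parked, not closed — `ledger route dormant route-FinalStateConjec (operator:999:3642015)
- 2026-08-30T17:13:23Z · REACTIVATED (open) — reconciler: reactivated — activity statement-checked at 2026-08-30T15:54:01Z after parking at 2026-08-24T06:17:28Z (operator:999:655471)

sub-problem: FinalStateConjecture · status: open · opened planner-plancard-FinalStateConjecture-FinalSt-4abc09e9-0 2026-08-15T15:00:18Z · rev 9 · ledger route-FinalStateConjecture-TwoBoundarySqueeze
GENERATED by the gate from the ledger (D-0016/17). Provers cite these decls: `theorem foo : Summit.FinalStateConjecture.FinalStateConjecture.Theses.TwoBoundarySqueeze.<Decl> := …` in Summits/FinalStateConjecture/FinalStateConjecture/Theorems/<Name>.lean.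
-/

namespace Summit.FinalStateConjecture.FinalStateConjecture.Theses.TwoBoundarySqueeze

open scoped BigOperators Topology Manifold Classical MeasureTheory ProbabilityTheory Matrix InnerProductSpace ComplexConjugate ContinuousMap
open Filter Set Function TopologicalSpace MeasureTheory

attribute [summit_statement] _root_.FinalStateConjecture

-- earlier SqueezeToKerrFamilyC0 (stmt-FinalStateConjecture-9994, replaced 2026-08-16T23:15:52Z -> stmt-FinalStateConjecture-17296): retired by None — ∀ (X : Type) [TopologicalSpace X] [ChartedSpace Literature.Geometry.Lorentzian.E3 X] [IsManifold (𝓡 3) ((⊤ : ℕ∞) : WithTop ℕ∞) X] [T2Space X] [SecondCountableTopology X] [ConnectedSpace X], ∀ D ∈ Literature.Geometry.Lorentzian.admissibleVacuumData X, ∀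
/-- item stmt-FinalStateConjecture-17296 · crux · rank 2 · open · by planner
why it might fail: All complete-scri data, not generic: it contains smooth Kerr uniqueness (open beyond near-Kerr/analytic: ChruscielCostaHeusler2012), no vacuum breathers (only exact periodicity is excluded, near scri: AlexakisSchlue2018), no eternal bound binary or endless cascade; at κ→0 no red-shift leg exists.
sources: ChruscielCostaHeusler2012, AlexakisSchlue2018, arXiv:1312.1989, BicakScholtzTod2010, AlexakisIonescuKlainerman2009, IonescuKlainerman2012
[crux] [card B2+B3+B4, C⁰ level, all data; re-typed 2026-08-16 for Statement p126844] for every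
connected Hausdorff second-countable 3-manifold X, every admissible vacuum datum D on X and every
maximal vacuum Cauchy development 𝒟 of D with complete future null infinity (sojourn form), there
are a region O and an N-black-hole final state decomposition d of O in C⁰ (N ≥ 0 boosted translated
Kerr exteriors with 0 < Mᵢ, |aᵢ| ≤ Mᵢ, near-zone C⁰ convergence on every truncated slab, separating
holes, a flat chart converging to η on the late half-space minus sublinear tubes) which is HONEST in
the summit's (re-typed) sense: O = J⁺(ιX) ∩ I⁻(d.charted) is the exterior the charts themselves
determine, every future-complete normalised null ray from Σ stays in closure O (RaysStayInClosure:
the settled region is not the witness's to choose), the charts EXHAUST O with honest growing radii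
Rᵢ(τ) ≥ max(r₊,0)+1, Rᵢ → ∞ (HasExhaustiveCharts), and chart time is the g-future (IsFutureOriented:
orthochronous motions, transported Kerr time vector / ∂₀ eventually future-directed on the certified
slabs). In words: complete 𝓘⁺ alone forces the exterior to settle, in C⁰, onto finitely many Kerr
black holes p -/
@[route_item "route-FinalStateConjecture-TwoBoundarySqueeze", crux]
def SqueezeToKerrFamilyC0 : Prop :=
  ∀ (X : Type) [TopologicalSpace X] [ChartedSpace Literature.Geometry.Lorentzian.E3 X] [IsManifold (𝓡 3) ((⊤ : ℕ∞) : WithTop ℕ∞) X] [T2Space X] [SecondCountableTopology X] [ConnectedSpace X], ∀ D ∈ Literature.Geometry.Lorentzian.admissibleVacuumData X, ∀ 𝒟 : Literature.Geometry.Lorentzian.VacuumCauchyDevelopment D, 𝒟.IsMaximal → Summit.FinalStateConjecture.HasCompleteNullInfinity 𝒟.toCauchyDevelopment → ∃ (O : Set 𝒟.carrier) (d : Literature.Geometry.Lorentzian.FinalStateDecomposition 𝒟.toSpacetime O 0), O = Summit.FinalStateConjecture.exteriorOf 𝒟.toCauchyDevelopment d.charted ∧ Summit.FinalStateConjecture.RaysStayInClosure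 𝒟.toCauchyDevelopment O ∧ Summit.FinalStateConjecture.HasExhaustiveCharts d ∧ Summit.FinalStateConjecture.IsFutureOriented d

-- earlier SubextremalUpgradeC2 (stmt-FinalStateConjecture-9995, replaced 2026-08-16T23:15:52Z -> stmt-FinalStateConjecture-17298): retired by None — ∀ (X : Type) [TopologicalSpace X] [ChartedSpace Literature.Geometry.Lorentzian.E3 X] [IsManifold (𝓡 3) ((⊤ : ℕ∞) : WithTop ℕ∞) X] [T2Space X] [SecondCountableTopology X] [ConnectedSpace X], ∀ D ∈ Literature.Geometry.Lorentzian.admissibleVacuumData X, ∀ 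
/-- item stmt-FinalStateConjecture-17298 · crux · rank 3 · open · by planner
why it might fail: Kerr stability for all |a|<M (Hintz2026, Thm 1.1) needs H^d-small polyhomogeneous data; C⁰-nearness in free charts controls neither derivatives nor tails: an eternal high-frequency (Burnett-type) graviton gas, or C⁰ charts fitting sub-extremal labels to extremal geometry, breaks the C² upgrade.
sources: Hintz2026, MaSzeftel2024, HuneauLuk2024survey, DafermosHolzegelRodnianskiTaylor2021, KlainermanSzeftel2023, GiorgiKlainermanSzeftel2022
[crux] [card B1+B5; re-typed 2026-08-16 for Statement p126844] for X, D, 𝒟 as above with complete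
𝓘⁺: if O carries an HONEST C⁰ final state decomposition d₀ (O = J⁺(ιX) ∩ I⁻(d₀.charted),
RaysStayInClosure O, HasExhaustiveCharts d₀, IsFutureOriented d₀) all of whose holes are
SUB-extremal (|aᵢ| < Mᵢ), then some region O′ carries an honest C² final state decomposition d with
sub-extremal holes (O′ = J⁺(ιX) ∩ I⁻(d.charted), RaysStayInClosure O′, HasExhaustiveCharts d,
IsFutureOriented d) — literally the summit's own conclusion for this development. In words: an
eternally C⁰-near-sub-extremal-Kerr vacuum exterior with complete 𝓘⁺ converges in C²; intended
proof: eventual uniform red-shift (κ → κ_∞ > 0) plus near-Kerr nonlinear observability (energy on a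
late leaf = flux through 𝓗⁺ ∪ 𝓘⁺ after it), Łojasiewicz–Simon near the Kerr manifold for the rate;
horizon-normalised, future-oriented charts then give HasExhaustiveCharts/IsFutureOriented, and
ray-closure is inherited from d₀ since both regions contain J⁺(ιX) ∩ J⁻(𝓘⁺). [deps:
CensoredExteriorsSettle] -/
@[route_item "route-FinalStateConjecture-TwoBoundarySqueeze", crux]
def SubextremalUpgradeC2 : Prop :=
  ∀ (X : Type) [TopologicalSpace X] [ChartedSpace Literature.Geometry.Lorentzian.E3 X] [IsManifold (𝓡 3) ((⊤ : ℕ∞) : WithTop ℕ∞) X] [T2Space X] [SecondCountableTopology X] [ConnectedSpace X], ∀ D ∈ Literature.Geometry.Lorentzian.admissibleVacuumData X, ∀ 𝒟 : Literature.Geometry.Lorentzian.VacuumCauchyDevelopment D, 𝒟.IsMaximal → Summit.FinalStateConjecture.HasCompleteNullInfinity 𝒟.toCauchyDevelopment → ∀ (O : Set 𝒟.carrier) (d₀ : Literature.Geometry.Lorentzian.FinalStateDecomposition 𝒟.toSpacetime O 0), O = Summit.FinalStateConjecture.exteriorOf 𝒟.toCauchyDevelopment d₀.charted → Summit.FinalStateConjecture.RaysStayInClosure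 𝒟.toCauchyDevelopment O → Summit.FinalStateConjecture.HasExhaustiveCharts d₀ → Summit.FinalStateConjecture.IsFutureOriented d₀ → (∀ i, Literature.Geometry.Lorentzian.Kerr.IsSubextremal (d₀.mass i) (d₀.spin i)) → ∃ (O' : Set 𝒟.carrier) (d : Literature.Geometry.Lorentzian.FinalStateDecomposition 𝒟.toSpacetime O' 2), (∀ i, Literature.Geometry.Lorentzian.Kerr.IsSubextremal (d.mass i) (d.spin i)) ∧ O' = Summit.FinalStateConjecture.exteriorOf 𝒟.toCauchyDevelopment d.charted ∧ Summit.FinalStateConjecture.RaysStayInClosure 𝒟.toCauchyDevelopment O' ∧ Summit.FinalStateConjecture.HasExhaustiveCharts d ∧ Summit.FinalStateConjecture.IsFutureOriented d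

-- earlier GenericCensorshipThirdLaw (stmt-FinalStateConjecture-9996, replaced 2026-08-16T23:15:52Z -> stmt-FinalStateConjecture-17297): retired by None — ∀ (X : Type) [TopologicalSpace X] [ChartedSpace Literature.Geometry.Lorentzian.E3 X] [IsManifold (𝓡 3) ((⊤ : ℕ∞) : WithTop ℕ∞) X] [T2Space X] [SecondCountableTopology X] [ConnectedSpace X], Literature.Geometry.Lorentzian.InitialDataSet.IsChristodou
/-- item stmt-FinalStateConjecture-17297 · crux · rank 4 · open · by planner
why it might fail: Both clauses open (WCC: Christodoulou1999; generic third law vs threshold extremality: KehleUnger2024); tame genericity is not ∧-closed and its witnesses must be same-end families wDist-continuous at c=0 (no such gluing in tree); if C⁰ labels are floppy (Q-C0) every black-hole datum is exceptional.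
sources: Christodoulou1999, DafermosLuk2017, KehleUnger2025, KehleUnger2024, arXiv:2402.10190, AngelopoulosKehleUnger2024
[crux] [imported input: clause (i) + generic third law, ONE tame-generic statement; re-typed
2026-08-16 for Statement p126844] for every X as above, the set of admissible vacuum data D for
which SOME maximal vacuum Cauchy development either has incomplete future null infinity or admits an
HONEST C⁰ final state decomposition (O = exteriorOf, RaysStayInClosure, HasExhaustiveCharts,
IsFutureOriented) containing a hole with |aᵢ| = Mᵢ has positive TAME codimension in Christodoulou's
sense inside the admissible class (IsTameChristodoulouGeneric … 1: through each such datum passes an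
injective one-parameter admissible family, jointly smooth, living on ONE fixed asymptotically flat
end with continuous mass, wDist-continuous and immersed at c = 0, all of whose other members have,
for every MGHD, complete 𝓘⁺ and only sub-extremal honest C⁰ endpoint configurations). This is weak
cosmic censorship in the audited typing conjoined ON THE SAME exceptional set with 'extremal black
holes do not form generically'; it carries no settling claim. It must be ONE crux: tame genericity
of P and of Q does not give genericity of P ∧ Q. -/
@[route_item "route-FinalStateConjecture-TwoBoundarySqueeze", crux]
def GenericCensorshipThirdLaw : Prop :=
  ∀ (X : Type) [TopologicalSpace X] [ChartedSpace Literature.Geometry.Lorentzian.E3 X] [IsManifold (𝓡 3) ((⊤ : ℕ∞) : WithTop ℕ∞) X] [T2Space X] [SecondCountableTopology X] [ConnectedSpace X], Literature.Geometry.Lorentzian.InitialDataSet.IsTameChristodoulouGeneric (Literature.Geometry.Lorentzian.admissibleVacuumData X) (fun D ↦ ∀ 𝒟 : Literature.Geometry.Lorentzian.VacuumCauchyDevelopment D, 𝒟.IsMaximal → Summit.FinalStateConjecture.HasCompleteNullInfinity 𝒟.toCauchyDevelopment ∧ ∀ (O : Set 𝒟.carrier) (d : Literature.Geometry.Lorentzian.FinalStateDecomposition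 𝒟.toSpacetime O 0), O = Summit.FinalStateConjecture.exteriorOf 𝒟.toCauchyDevelopment d.charted → Summit.FinalStateConjecture.RaysStayInClosure 𝒟.toCauchyDevelopment O → Summit.FinalStateConjecture.HasExhaustiveCharts d → Summit.FinalStateConjecture.IsFutureOriented d → ∀ i, Literature.Geometry.Lorentzian.Kerr.IsSubextremal (d.mass i) (d.spin i)) 1

/-- item stmt-FinalStateConjecture-9937 · crux · rank 9 · open · by planner
why it might fail: Known in print (CBG 1969 Thm 3; unproved XL Literature fact) but typed over the REPAIRED prelude: IsMaximal asks EVERY typed VacuumCauchyDevelopment of D to embed; a rogue typed development, as over the first uninhabited rendering, would kill it.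
sources: ChoquetBruhatGeroch1969CMP, Ringstrom2009, Sbierski2016AHP, Literature.Geometry.Lorentzian.CauchyProblemExistenceDefect
[support] every admissible datum has a maximal globally hyperbolic vacuum development, stated over
the repaired structure `VacuumCauchyDevelopment` (the corrected form of the deprecated
`choquetBruhat_geroch_exists_mghd`, recorded in `CauchyProblemExistenceDefect`);
Choquet-Bruhat–Geroch 1969 Thm. 3, Sbierski 2016 Thm. 2.6. Known theorem; large formalisation;
shared by every route of this summit. [difficulty: XL] -/
@[route_item "route-FinalStateConjecture-TwoBoundarySqueeze", crux]
def MGHDExists : Prop :=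
  ∀ (X : Type) [TopologicalSpace X] [ChartedSpace Literature.Geometry.Lorentzian.E3 X] [IsManifold (𝓡 3) ((⊤ : ℕ∞) : WithTop ℕ∞) X] [T2Space X] [SecondCountableTopology X] [ConnectedSpace X], ∀ D ∈ Literature.Geometry.Lorentzian.admissibleVacuumData X, ∃ 𝒟 : Literature.Geometry.Lorentzian.VacuumCauchyDevelopment D, 𝒟.IsMaximal

/-- item stmt-FinalStateConjecture-9997 · assembly · rank 1 · open · by planner
sources: DafermosLuk2017, Christodoulou1999
[assembly] SqueezeToKerrFamilyC0 → SubextremalUpgradeC2 → GenericCensorshipThirdLaw → MGHDExists →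
FinalStateConjecture (the root-level summit statement of
Summits/FinalStateConjecture/FinalStateConjecture/Statement.lean). -/
@[route_item "route-FinalStateConjecture-TwoBoundarySqueeze"]
def Assembly : Prop :=
  SqueezeToKerrFamilyC0 → SubextremalUpgradeC2 → GenericCensorshipThirdLaw → MGHDExists → FinalStateConjecture

/-! D-0027 §2.1 — DECIDING THEOREM (planner-authored via `route open/edit --closes-file`; by planner-rbadge-FinalStateConjecture-TwoBoundar-b7939054-0 2026-08-16T23:39:32Z):
its hypotheses are this route's items and its conclusion the sub-problem Statement (glue_lint), and it elaborates with this file. -/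

@[closes "route-FinalStateConjecture-TwoBoundarySqueeze"] theorem closes (hK1 : SqueezeToKerrFamilyC0) (hK2 : SubextremalUpgradeC2)
    (hG : GenericCensorshipThirdLaw) (hS : MGHDExists) : FinalStateConjecture := by
  intro X _ _ _ _ _ _
  -- Re-certified 2026-08-16 (route-repair rbadge, glue) against Statement p126844 (re-type T2):
  -- TAME Christodoulou codimension is antitone in the exceptional set —
  -- P → Q pointwise on 𝓓 gives IsTameChristodoulouGeneric 𝓓 P 1 → IsTameChristodoulouGeneric 𝓓 Q 1
  -- (same fixed end `e`, same tame immersed injective admissible family; only the escape clause is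
  -- re-read). Proved inline (it is `InitialDataSet.IsTameChristodoulouGeneric.mono` of
  -- Literature/Geometry/Lorentzian/TameGenericityDiagonal.lean, kept out of the import cone).
  have mono : ∀ {P Q : Literature.Geometry.Lorentzian.InitialDataSet (modelWithCornersSelf ℝ (EuclideanSpace ℝ (Fin 3))) X → Prop},
      Literature.Geometry.Lorentzian.InitialDataSet.IsTameChristodoulouGeneric
          (Literature.Geometry.Lorentzian.admissibleVacuumData X) P 1 →
        (∀ D ∈ Literature.Geometry.Lorentzian.admissibleVacuumData X, P D → Q D) →
          Literature.Geometry.Lorentzian.InitialDataSet.IsTameChristodoulouGeneric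
            (Literature.Geometry.Lorentzian.admissibleVacuumData X) Q 1 := by
    intro P Q h hPQ d hd
    obtain ⟨e, F, hF, himm, h0, hinj, hDF, hE⟩ := h d ⟨hd.1, fun hP => hd.2 (hPQ d hd.1 hP)⟩
    exact ⟨e, F, hF, himm, h0, hinj, hDF,
      fun c hc hc' => hE c hc ⟨hc'.1, fun hP => hc'.2 (hPQ _ hc'.1 hP)⟩⟩
  -- P := the generic property of G (complete 𝓘⁺ ∧ every HONEST C⁰ endpoint configuration —
  -- self-determined exterior, rays stay in its closure, exhaustive charts with honest radii,
  -- future-oriented chart time — is sub-extremal), Q := the summit's property. Pointwise on 𝓓: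
  -- S gives the MGHD, K1 the honest exhaustive C⁰ decomposition d₀ of O, G's clause (ii) makes d₀
  -- sub-extremal, K2 upgrades it to the summit's conjunct verbatim (sub-extremal C² decomposition d
  -- of O′ = exteriorOf d.charted with RaysStayInClosure O′, HasExhaustiveCharts d, IsFutureOriented d).
  refine mono (hG X) ?_
  intro D hD hP
  refine ⟨hS X D hD, fun 𝒟 h𝒟 => ?_⟩
  obtain ⟨hCNI, hsub⟩ := hP 𝒟 h𝒟
  obtain ⟨O, d₀, hO, hrays, hex, hfo⟩ := hK1 X D hD 𝒟 h𝒟 hCNI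
  exact ⟨hCNI, hK2 X D hD 𝒟 h𝒟 hCNI O d₀ hO hrays hex hfo (hsub O d₀ hO hrays hex hfo)⟩

end Summit.FinalStateConjecture.FinalStateConjecture.Theses.TwoBoundarySqueeze
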